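import Summits.HodgeConjecture.HodgeConjecture.Theses.TropicalWeilObstruction
import Summits.HodgeConjecture.HodgeConjecture.Theorems.TropicalWeilObstructionTropicalWeilVanishingClassPositivityTransport
import Summits.HodgeConjecture.HodgeConjecture.Theorems.TropicalWeilObstructionTropicalWeilVanishingFlatObstructionLinAlg
import HarnessLib

/-!
# Route `TropicalWeilObstruction` (Kontsevich's tropical test — NEGATION SINK, exploration, no summit claim):
# class positivity is exhausted by the calibration cone at every Weil period (IV) — phase rotations

Negation-sink bookkeeping of the cell `pub-hodge-tropical` (seat tropical-2 gen 5). Part IV (of V) of the all-periods transport of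
tropical-1's κ = 8 certificate (p337681): the tools that turn the boundary RAY `8 θ₄(Q) + Re w(Q)` (Parts I–III:
`…ClassPositivity{Transport,AllPeriods,FrameDensity}`) into the whole boundary CIRCLE of the calibration cone.

* `M_mul` — `M_{hk} = M_h · M_k` for real `h`, `k` commuting with `J` (`hΩ = Ω M_h`, `PΩ = 2`), generalising Part I's `M_mul_M_eq`;
* `pushforward_thetaClass_one'` — the congruence by a general real `h` maps `θ₄(1)` to `θ₄(h hᵀ)` (Part I assumed `hᵀ = h`);
* the phase rotations `g = a·1 + b·J`: `rot_mul_weilJ` (commutes with `J`), `rot_mul_comm` (commutes with every `J`-commuting `Q`),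
  `rot_mul_transpose` (`g gᵀ = 1` when `a² + b² = 1`), `weilJ_map_mul_omega` (`J Ω = i Ω`: `Ω` spans the `i`-eigenspace of `J`),
  `M_rot` (`M_g = (a + ib)·1`, so `det M_g = (a + ib)⁴`).

HONEST STATUS. Linear algebra; decides nothing about K1 (`TropicalWeilVanishing`, stmt-HodgeConjecture-18478) or about the Hodge
conjecture. No definition, no named fact, no sorry.
References: [Zharkov2020TropicalWeil] I. Zharkov, arXiv:2002.02347, §2 (pp. 2–4) (the Weil tori `Q = [[A,B],[-B,A]]`, `J`, `Ω`);
[MikhalkinZharkov2014Eigenwave] G. Mikhalkin, I. Zharkov, LN UMI 15 (2014), Prop. 4.3; Cauchy–Binet [folklore].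
-/

set_option linter.dupNamespace false

noncomputable section

open scoped BigOperators
open Matrix
open Literature.AlgebraicGeometry.Tropical
open Summit.HodgeConjecture.HodgeConjecture.Theorems.TropicalHodgeBound

namespace Summit.HodgeConjecture.HodgeConjecture.Theorems.TropicalWeilVanishing.Kappa

/-! ## §0 Display-only notation (verbatim bodies of Parts I–III; nothing is defined) -/

/-- `P = [1 | i·1]`. -/
local notation3 (prettyPrint := false) "𝐏⟦" n "⟧" =>
  (Matrix.of fun (k : Fin n) (a : Fin (2 * n)) =>
    (if (a : ℕ) = (k : ℕ) then (1 : ℂ) else 0) + (if (a : ℕ) = (k : ℕ) + n then Complex.I else 0))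

/-- The skeleton's `thetaClass n Q`. -/
local notation3 (prettyPrint := false) "θ⟦" n "⟧" Q:max =>
  (fun S S' : Fin n → Fin (2 * n) => Matrix.det (Matrix.submatrix Q S S'))

/-- The skeleton's `omegaFrame n` (`Ω = Pᴴ`). -/
local notation3 (prettyPrint := false) "Ω⟦" n "⟧" =>
  (Matrix.of fun (a : Fin (2 * n)) (b : Fin n) =>
    (if (a : ℕ) = (b : ℕ) then (1 : ℂ) else 0) - (if (a : ℕ) = (b : ℕ) + n then Complex.I else 0))

/-- `M_Q := ½ · P Q Pᴴ`. -/
local notation3 (prettyPrint := false) "𝐌⟦" n "⟧" Q:max =>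
  ((2 : ℂ)⁻¹ • (𝐏⟦n⟧ * Matrix.map Q ((↑) : ℝ → ℂ) * (𝐏⟦n⟧)ᴴ))

/-! ## §1 Two generalisations of Part I (non-symmetric `h`) -/

/-- **`M_{hk} = M_h · M_k`** for `h`, `k` commuting with `J`. [cite: Zharkov2020TropicalWeil, §2] -/
theorem M_mul (h k : Matrix (Fin (2 * 4)) (Fin (2 * 4)) ℝ) (hJ : h * weilJ 4 = weilJ 4 * h)
    (kJ : k * weilJ 4 = weilJ 4 * k) : 𝐌⟦4⟧ (h * k) = 𝐌⟦4⟧ h * 𝐌⟦4⟧ k := by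
  have hkJ : (h * k) * weilJ 4 = weilJ 4 * (h * k) := by
    rw [Matrix.mul_assoc, kJ, ← Matrix.mul_assoc, hJ, Matrix.mul_assoc]
  have hmap : (h * k).map ((↑) : ℝ → ℂ) = h.map ((↑) : ℝ → ℂ) * k.map ((↑) : ℝ → ℂ) :=
    Matrix.map_mul (f := Complex.ofRealHom)
  have hPΩ : 𝐏⟦4⟧ * Ω⟦4⟧ = (2 : ℂ) • (1 : Matrix (Fin 4) (Fin 4) ℂ) := by
    rw [← frame_conjTranspose_eq]; exact frame_mul_frame_conjTranspose
  have hΩ : Ω⟦4⟧ * 𝐌⟦4⟧ (h * k) = Ω⟦4⟧ * (𝐌⟦4⟧ h * 𝐌⟦4⟧ k) := by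
    calc Ω⟦4⟧ * 𝐌⟦4⟧ (h * k) = (h * k).map ((↑) : ℝ → ℂ) * Ω⟦4⟧ := (map_mul_omega_eq_omega_mul (h * k) hkJ).symm
      _ = h.map ((↑) : ℝ → ℂ) * (k.map ((↑) : ℝ → ℂ) * Ω⟦4⟧) := by rw [hmap, Matrix.mul_assoc]
      _ = h.map ((↑) : ℝ → ℂ) * (Ω⟦4⟧ * 𝐌⟦4⟧ k) := by rw [map_mul_omega_eq_omega_mul k kJ]
      _ = (h.map ((↑) : ℝ → ℂ) * Ω⟦4⟧) * 𝐌⟦4⟧ k := (Matrix.mul_assoc _ _ _).symm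
      _ = (Ω⟦4⟧ * 𝐌⟦4⟧ h) * 𝐌⟦4⟧ k := by rw [map_mul_omega_eq_omega_mul h hJ]
      _ = Ω⟦4⟧ * (𝐌⟦4⟧ h * 𝐌⟦4⟧ k) := Matrix.mul_assoc _ _ _
  have hP : (2 : ℂ) • 𝐌⟦4⟧ (h * k) = (2 : ℂ) • (𝐌⟦4⟧ h * 𝐌⟦4⟧ k) := by
    calc (2 : ℂ) • 𝐌⟦4⟧ (h * k) = ((2 : ℂ) • (1 : Matrix (Fin 4) (Fin 4) ℂ)) * 𝐌⟦4⟧ (h * k) := by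
          rw [Matrix.smul_mul, Matrix.one_mul]
      _ = 𝐏⟦4⟧ * (Ω⟦4⟧ * 𝐌⟦4⟧ (h * k)) := by rw [← hPΩ, Matrix.mul_assoc]
      _ = 𝐏⟦4⟧ * (Ω⟦4⟧ * (𝐌⟦4⟧ h * 𝐌⟦4⟧ k)) := by rw [hΩ]
      _ = (2 : ℂ) • (𝐌⟦4⟧ h * 𝐌⟦4⟧ k) := by rw [← Matrix.mul_assoc, hPΩ, Matrix.smul_mul, Matrix.one_mul]
  exact smul_right_injective _ (two_ne_zero' ℂ) hP

/-- **Push-forward of `θ₄(1)` by a general `h` is `θ₄(h hᵀ)`:**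
`Σ_{I,I'} det h[S,I] det h[S',I'] det 1[I,I'] = 576 · det (h hᵀ)[S,S']`. [folklore] -/
theorem pushforward_thetaClass_one' (h : Matrix (Fin (2 * 4)) (Fin (2 * 4)) ℝ) (S S' : Fin 4 → Fin (2 * 4)) :
    ∑ I : Fin 4 → Fin (2 * 4), ∑ I' : Fin 4 → Fin (2 * 4),
        (h.submatrix S I).det * (h.submatrix S' I').det *
          ((1 : Matrix (Fin (2 * 4)) (Fin (2 * 4)) ℝ).submatrix I I').det =
      (576 : ℝ) * ((h * hᵀ).submatrix S S').det := by
  have hinner : ∀ I : Fin 4 → Fin (2 * 4),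
      ∑ I' : Fin 4 → Fin (2 * 4), (h.submatrix S' I').det *
          ((1 : Matrix (Fin (2 * 4)) (Fin (2 * 4)) ℝ).submatrix I I').det = 24 * (h.submatrix S' I).det := by
    intro I
    have hcb := det_submatrix_mul_eq_sum h ((1 : Matrix (Fin (2 * 4)) (Fin (2 * 4)) ℝ).submatrix id I) S'
    have hmul : h * ((1 : Matrix (Fin (2 * 4)) (Fin (2 * 4)) ℝ).submatrix id I) = h.submatrix id I := by
      ext a b
      simp [Matrix.mul_apply, Matrix.submatrix_apply, Matrix.one_apply]
    rw [hmul, show (h.submatrix id I).submatrix S' id = h.submatrix S' I from rfl] at hcb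
    rw [hcb]
    refine Finset.sum_congr rfl fun I' _ => ?_
    congr 1
    rw [show ((1 : Matrix (Fin (2 * 4)) (Fin (2 * 4)) ℝ).submatrix id I).submatrix I' id =
        (((1 : Matrix (Fin (2 * 4)) (Fin (2 * 4)) ℝ).submatrix I I')ᵀ) from by
          ext a b; simp [Matrix.transpose_apply, Matrix.submatrix_apply, Matrix.one_apply, eq_comm],
      Matrix.det_transpose]
  calc ∑ I : Fin 4 → Fin (2 * 4), ∑ I' : Fin 4 → Fin (2 * 4),
        (h.submatrix S I).det * (h.submatrix S' I').det *
          ((1 : Matrix (Fin (2 * 4)) (Fin (2 * 4)) ℝ).submatrix I I').det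
      = ∑ I : Fin 4 → Fin (2 * 4), (h.submatrix S I).det *
          ∑ I' : Fin 4 → Fin (2 * 4), (h.submatrix S' I').det *
            ((1 : Matrix (Fin (2 * 4)) (Fin (2 * 4)) ℝ).submatrix I I').det := by
        refine Finset.sum_congr rfl fun I _ => ?_
        rw [Finset.mul_sum]
        exact Finset.sum_congr rfl fun I' _ => by ring
    _ = 24 * ∑ I : Fin 4 → Fin (2 * 4), (hᵀ.submatrix I S).det * (hᵀ.submatrix I S').det := by
        rw [Finset.mul_sum]
        refine Finset.sum_congr rfl fun I _ => ?_
        rw [hinner I, ← Matrix.transpose_submatrix, Matrix.det_transpose, ← Matrix.transpose_submatrix,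
          Matrix.det_transpose]
        ring
    _ = (576 : ℝ) * ((h * hᵀ).submatrix S S').det := by
        have h24 := det_submatrix_transpose_mul_self_eq_sum hᵀ S S'
        rw [Matrix.transpose_transpose] at h24
        rw [← h24]
        ring

/-! ## §2 Phase rotations `g = a·1 + b·J` -/

/-- The rotation `g = a·1 + b·J` commutes with `J`. [folklore] -/
theorem rot_mul_weilJ (a b : ℝ) :
    (a • (1 : Matrix (Fin (2 * 4)) (Fin (2 * 4)) ℝ) + b • weilJ 4) * weilJ 4 =
      weilJ 4 * (a • (1 : Matrix (Fin (2 * 4)) (Fin (2 * 4)) ℝ) + b • weilJ 4) := by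
  rw [Matrix.add_mul, Matrix.mul_add, Matrix.smul_mul, Matrix.mul_smul, Matrix.smul_mul, Matrix.mul_smul,
    Matrix.one_mul, Matrix.mul_one]

/-- The rotation commutes with every `J`-commuting `Q`. [folklore] -/
theorem rot_mul_comm (a b : ℝ) (Q : Matrix (Fin (2 * 4)) (Fin (2 * 4)) ℝ) (hJ : Q * weilJ 4 = weilJ 4 * Q) :
    (a • (1 : Matrix (Fin (2 * 4)) (Fin (2 * 4)) ℝ) + b • weilJ 4) * Q =
      Q * (a • (1 : Matrix (Fin (2 * 4)) (Fin (2 * 4)) ℝ) + b • weilJ 4) := by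
  rw [Matrix.add_mul, Matrix.mul_add, Matrix.smul_mul, Matrix.mul_smul, Matrix.smul_mul, Matrix.mul_smul,
    Matrix.one_mul, Matrix.mul_one, hJ]

/-- The rotation is orthogonal when `a² + b² = 1`: `g gᵀ = 1` (`Jᵀ = -J`, `J² = -1`). [folklore] -/
theorem rot_mul_transpose (a b : ℝ) (hab : a ^ 2 + b ^ 2 = 1) :
    (a • (1 : Matrix (Fin (2 * 4)) (Fin (2 * 4)) ℝ) + b • weilJ 4) *
        (a • (1 : Matrix (Fin (2 * 4)) (Fin (2 * 4)) ℝ) + b • weilJ 4)ᵀ = 1 := by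
  have hT : (a • (1 : Matrix (Fin (2 * 4)) (Fin (2 * 4)) ℝ) + b • weilJ 4)ᵀ =
      a • (1 : Matrix (Fin (2 * 4)) (Fin (2 * 4)) ℝ) - b • weilJ 4 := by
    rw [Matrix.transpose_add, Matrix.transpose_smul, Matrix.transpose_smul, Matrix.transpose_one,
      TropicalWeilSupply.Negative.weilJ_transpose, smul_neg, sub_eq_add_neg]
  have hJJ : weilJ 4 * weilJ 4 = -(1 : Matrix (Fin (2 * 4)) (Fin (2 * 4)) ℝ) := weilJ_mul_weilJ 4
  have e1 : (a • (1 : Matrix (Fin (2 * 4)) (Fin (2 * 4)) ℝ) + b • weilJ 4) *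
      (a • (1 : Matrix (Fin (2 * 4)) (Fin (2 * 4)) ℝ) - b • weilJ 4) =
      (a * a) • (1 : Matrix (Fin (2 * 4)) (Fin (2 * 4)) ℝ) - (b * b) • (weilJ 4 * weilJ 4) := by
    simp only [Matrix.add_mul, Matrix.mul_sub, Matrix.smul_mul, Matrix.mul_smul, Matrix.one_mul, Matrix.mul_one]
    module
  rw [hT, e1, hJJ, smul_neg, sub_neg_eq_add, ← add_smul]
  have h1 : a * a + b * b = 1 := by nlinarith [hab]
  rw [h1, one_smul]

/-- **`J Ω = i Ω`:** the columns `ω_b = e_b - i e_{b+4}` of `Ω` span the `i`-eigenspace of `J`. [cite: Zharkov2020TropicalWeil, §2] -/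
theorem weilJ_map_mul_omega : (weilJ 4).map ((↑) : ℝ → ℂ) * Ω⟦4⟧ = Complex.I • Ω⟦4⟧ := by
  ext a b
  simp only [Matrix.mul_apply, Matrix.map_apply, Matrix.of_apply, Matrix.smul_apply, smul_eq_mul, weilJ]
  rw [Fin.sum_univ_eight]
  fin_cases a <;> fin_cases b <;> norm_num

/-- **`M_g = (a + ib)·1`** for the rotation `g = a·1 + b·J` (so `det M_g = (a+ib)⁴`). [cite: Zharkov2020TropicalWeil, §2] -/
theorem M_rot (a b : ℝ) :
    𝐌⟦4⟧ (a • (1 : Matrix (Fin (2 * 4)) (Fin (2 * 4)) ℝ) + b • weilJ 4) =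
      ((a : ℂ) + (b : ℂ) * Complex.I) • (1 : Matrix (Fin 4) (Fin 4) ℂ) := by
  have hPΩ : 𝐏⟦4⟧ * Ω⟦4⟧ = (2 : ℂ) • (1 : Matrix (Fin 4) (Fin 4) ℂ) := by
    rw [← frame_conjTranspose_eq]; exact frame_mul_frame_conjTranspose
  have hmap : (a • (1 : Matrix (Fin (2 * 4)) (Fin (2 * 4)) ℝ) + b • weilJ 4).map ((↑) : ℝ → ℂ) =
      (a : ℂ) • (1 : Matrix (Fin (2 * 4)) (Fin (2 * 4)) ℂ) + (b : ℂ) • (weilJ 4).map ((↑) : ℝ → ℂ) := by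
    ext x y
    simp only [Matrix.map_apply, Matrix.add_apply, Matrix.smul_apply, smul_eq_mul, Matrix.one_apply,
      Complex.ofReal_add, Complex.ofReal_mul]
    split_ifs <;> simp
  rw [hmap, frame_conjTranspose_eq, Matrix.mul_assoc, Matrix.add_mul, Matrix.smul_mul, Matrix.smul_mul,
    Matrix.one_mul, weilJ_map_mul_omega, Matrix.mul_add, Matrix.mul_smul, Matrix.mul_smul, Matrix.mul_smul, hPΩ,
    smul_smul, smul_smul, smul_smul, ← add_smul, smul_smul, ← Complex.ofReal_ofNat]
  congr 1
  push_cast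
  ring

end Summit.HodgeConjecture.HodgeConjecture.Theorems.TropicalWeilVanishing.Kappa

end
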